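import Summits.BirchSwinnertonDyer.BirchSwinnertonDyer.Theorems.ByReductionTypeAtTwoSupersingularFlatLiftAssemblyTop
import Literature.NumberTheory.EllipticCurves.IwasawaSelmerControlLocalizationProofs
import HarnessLib

/-!
# «LOC» AT A FINITE PLACE `w ∤ p` REDUCED TO A LOCAL STATEMENT: the single-place local lift of the COUNT♭@2 door
# follows from the surjectivity `𝒫_E(K_w) ↠ 𝒫_E((K_∞)_η)^{Γ_η}` (Greenberg p. 108) — THEOREM

Seat `bsd-2adic-ss-1` GEN 12, crux `SupersingularRankZeroAtTwo` (item stmt-BirchSwinnertonDyer-19097, route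
`ByReductionTypeAtTwo`, rung K4), line `flat_uniform_two` v1, stub (2) `stub_allFlatData`, conjunct COUNT♭@2 —
part 13. The doors of parts 9/12 display, for each finite `w ∈ Σ₀ ∪ {2}`, the hypothesis «LOC»: for every `t` in
`H¹(ℚ_Σ/ℚ_∞, E[2^∞])` with `conj_σ t − t ∈ Sel♭_∞` for all `σ`, a `p`-power-torsion local class `x_w ∈ H¹(Γ_{ℚ_w},
E(ℚ̄_w))` such that `loc_w y = x_w` forces `t − res y` into the classical local condition at the chosen place above
`w`. This file proves, for every number field `K`, every `ℤ_p`-extension `κ`, every `K`-field `E` (a completion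
`K_w`) and every subgroup `Sel ≤ 𝒦_w = localKerOver`: «LOC at `w`» ⟸ the LOCAL statement «every `Γ_E`-invariant
`p`-power-torsion class of `H¹(H_{E,∞}, E(K̄_E))` is the restriction of a `p`-power-torsion class of
`H¹(Γ_E, E(K̄_E))`» (= `𝒫_E(K_w) → 𝒫_E((K_∞)_η)^{Γ_η}` onto, Greenberg LNM 1716 p. 108, cited by name as
`Greenberg1999.localQuotient_restriction_surjective`; kernel-able: `cd_p Γ_η = 1` + «`Im κ_η = 0`», Prop. 2.1).
Ingredients: equivariance of localisation for the decomposition group (`localResOver_conjH1_resGal`), the local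
condition of `Sel` (`loc_w s = 0`), and `loc_w ∘ res = r_w ∘ loc_w` (`localResOverOfEmb_resOfLe`).
Nothing about any curve is asserted; BSD is not proved by any of this.

References: [GreenbergLNM1716] §2 p. 71, §3 p. 86, §4 p. 108.
-/

set_option autoImplicit false
-- the Theorems namespace of this sub repeats the summit name by design (D-0017 nested layout)
set_option linter.dupNamespace false

noncomputable section

open scoped Classical NumberField

open NumberField IsDedekindDomain

universe u

namespace Summit.BirchSwinnertonDyer.BirchSwinnertonDyer.Theorems.SSFlatEC

open Literature.NumberTheory.EllipticCurves Literature.NumberTheory.GaloisRepresentations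
  WeierstrassCurve ZpExtension

variable {K : Type u} [Field K] [NumberField K] (W : WeierstrassCurve K) {p : ℕ} [Fact p.Prime]
  (κ : ZpExtension K p) {E : Type u} [Field E] [Algebra K E]

/-- **«LOC at `w`» from the local surjectivity `𝒫_E(K_w) ↠ 𝒫_E((K_∞)_η)^{Γ_η}`.** Let `Sel ≤ 𝒦_w`
(`localKerOver`, the classical local condition at the chosen place of `K_∞` above `w`, `E = K_w`) and
`t ∈ H¹(K_∞, E[p^∞])` with `conj_σ t − t ∈ Sel` for all `σ ∈ Γ_K`. Then `c = loc_w t ∈ H¹(H_{E,∞}, E(K̄_E))` is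
`p`-power torsion and fixed by the decomposition group (`loc_w (conj_{δ|} t) = conj_δ (loc_w t)`,
`localResOver_conjH1_resGal`, and `loc_w` kills `Sel`); if every such class is `r_w x` for a `p`-power-torsion
`x ∈ H¹(Γ_E, E(K̄_E))` (hypothesis `hsurj`: Greenberg p. 108), then `x_w = x` works: `loc_w (res y) = r_w (loc_w y)`
(`localResOverOfEmb_resOfLe`), so `loc_w y = x_w` gives `loc_w (t − res y) = c − r_w x = 0`.
[cite: GreenbergLNM1716, §4 p. 108 («𝒫_E^{(v)}(F) → 𝒫_E^{(v)}(F_∞)^Γ is surjective»); §2 p. 71] -/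
theorem exists_localLift_of_localSurj
    (hsurj : ∀ c : discreteH1 (localSubgroup κ.kerSubgroup E) (localPoints W E),
      (∃ k : ℕ, p ^ k • c = 0) →
      (∀ δ : Field.absoluteGaloisGroup E,
        Literature.NumberTheory.EllipticCurves.conjH1 (localSubgroup κ.kerSubgroup E) (localPoints W E) δ c = c) →
      ∃ x : discreteH1 (localSubgroup (⊤ : Subgroup (Field.absoluteGaloisGroup K)) E) (localPoints W E),
        (∃ k : ℕ, p ^ k • x = 0) ∧
        Literature.NumberTheory.EllipticCurves.resOfLe (localPoints W E)
          (Subgroup.comap_mono le_top :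
            localSubgroup κ.kerSubgroup E ≤ localSubgroup (⊤ : Subgroup (Field.absoluteGaloisGroup K)) E) x = c)
    (Sel : AddSubgroup (W.subgroupH1 p κ.kerSubgroup)) (hSel : Sel ≤ W.localKerOver p κ.kerSubgroup E)
    (t : W.subgroupH1 p κ.kerSubgroup)
    (ht : ∀ σ : Field.absoluteGaloisGroup K, W.conjH1 p κ.kerSubgroup σ t - t ∈ Sel) :
    ∃ xw : discreteH1 (localSubgroup (⊤ : Subgroup (Field.absoluteGaloisGroup K)) E) (localPoints W E),
      (∃ k : ℕ, p ^ k • xw = 0) ∧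
      ∀ y : W.subgroupH1 p (⊤ : Subgroup (Field.absoluteGaloisGroup K)),
        W.localResOver p ⊤ E y = xw →
        t - W.resOfLe p (le_top : κ.kerSubgroup ≤ ⊤) y ∈ W.localKerOver p κ.kerSubgroup E := by
  -- the local class of `t`: `p`-power torsion and invariant under the decomposition group
  have htors : ∃ k : ℕ, p ^ k • W.localResOver p κ.kerSubgroup E t = 0 := by
    obtain ⟨k, hk⟩ := W.exists_pow_smul_subgroupH1_ker_eq_zero κ t
    exact ⟨k, by rw [← map_nsmul, hk, map_zero]⟩
  have hinv : ∀ δ : Field.absoluteGaloisGroup E,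
      Literature.NumberTheory.EllipticCurves.conjH1 (localSubgroup κ.kerSubgroup E) (localPoints W E) δ
        (W.localResOver p κ.kerSubgroup E t) = W.localResOver p κ.kerSubgroup E t := fun δ ↦ by
    rw [← localResOver_conjH1_resGal]
    have hs := hSel (ht (resGal (K := K) E δ))
    rw [mem_localKerOver_iff, map_sub, sub_eq_zero] at hs
    exact hs
  obtain ⟨x, hx, hrx⟩ := hsurj _ htors hinv
  refine ⟨x, hx, fun y hy ↦ ?_⟩
  rw [mem_localKerOver_iff, map_sub, sub_eq_zero]
  have hnat := W.localResOverOfEmb_resOfLe p (closureEmb (K := K) E) (le_top : κ.kerSubgroup ≤ ⊤) y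
  have hy' : W.localResOverOfEmb p ⊤ (closureEmb (K := K) E) y = x := hy
  have h0 : W.localResOver p κ.kerSubgroup E (W.resOfLe p (le_top : κ.kerSubgroup ≤ ⊤) y) =
      W.localResOver p κ.kerSubgroup E t :=
    hnat.trans ((congrArg _ hy').trans hrx)
  exact h0.symm

/-- **«LOC at `w`» for the classical Selmer condition** (`Sel = 𝒦_w` itself): the special case used when the
`conj_σ t − t` lie in a Selmer group all of whose local conditions away from `2` are the classical ones (e.g.
`Sel♭_∞ ≤ 𝒦_w` for `w ≠ v`). [cite: GreenbergLNM1716, §4 p. 108; §2 p. 71] -/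
theorem exists_localLift_of_localSurj_of_le {Sel : AddSubgroup (W.subgroupH1 p κ.kerSubgroup)}
    (hSel : Sel ≤ W.localKerOver p κ.kerSubgroup E)
    (hsurj : ∀ c : discreteH1 (localSubgroup κ.kerSubgroup E) (localPoints W E),
      (∃ k : ℕ, p ^ k • c = 0) →
      (∀ δ : Field.absoluteGaloisGroup E,
        Literature.NumberTheory.EllipticCurves.conjH1 (localSubgroup κ.kerSubgroup E) (localPoints W E) δ c = c) →
      ∃ x : discreteH1 (localSubgroup (⊤ : Subgroup (Field.absoluteGaloisGroup K)) E) (localPoints W E),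
        (∃ k : ℕ, p ^ k • x = 0) ∧
        Literature.NumberTheory.EllipticCurves.resOfLe (localPoints W E)
          (Subgroup.comap_mono le_top :
            localSubgroup κ.kerSubgroup E ≤ localSubgroup (⊤ : Subgroup (Field.absoluteGaloisGroup K)) E) x = c) :
    ∀ t : W.subgroupH1 p κ.kerSubgroup,
      (∀ σ : Field.absoluteGaloisGroup K, W.conjH1 p κ.kerSubgroup σ t - t ∈ Sel) →
      ∃ xw : discreteH1 (localSubgroup (⊤ : Subgroup (Field.absoluteGaloisGroup K)) E) (localPoints W E),
        (∃ k : ℕ, p ^ k • xw = 0) ∧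
        ∀ y : W.subgroupH1 p (⊤ : Subgroup (Field.absoluteGaloisGroup K)),
          W.localResOver p ⊤ E y = xw →
          t - W.resOfLe p (le_top : κ.kerSubgroup ≤ ⊤) y ∈ W.localKerOver p κ.kerSubgroup E :=
  fun t ht ↦ exists_localLift_of_localSurj W κ hsurj Sel hSel t ht

end Summit.BirchSwinnertonDyer.BirchSwinnertonDyer.Theorems.SSFlatEC

end
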